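import Literature.Probability.Percolation.ArmSeparationExtGuard
import Literature.Probability.Percolation.ArmSeparationInnerFrames
import HarnessLib

/-!
# Outer separation of two arms in the six axis-compatible frames, with corner guards

Topic: Probability / Percolation; family `crit-perc` (`P = P_{1/2} = triSitePercolation half`). A
brick of the discharge of `Literature.Probability.Percolation.Nolin2008_twoArm_separation`
(Nolin 2008, Thm. 11 [arXiv 0711.4948: Thm. 10], `j = 2`, `σ = BW`; `ArmSeparation.lean`): the step
`f (K+1) ≤ g (K+1) + ε · f K` of the multi-scale scheme (`ArmSeparationScheme.lean`) for the
EXTERNAL extremities (Nolin 2008, §4.4, p. 12: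
`A_{j,σ}(2^k,2^K) ⊆ Ã^{·/η'}(2^k,2^K) ∪ ({one of the U-shaped regions fails} ∩ A(2^k,2^{K-1}))`, and
"by independence of the two latter events,
`P(A(2^k,2^K)) ≤ P(Ã^{·/η'}(2^k,2^K)) + 4δ P(A(2^k,2^{K-1}))`").
`ArmSeparationOuter.lean` fences the outer tips in the rotated frames `rotConfig i`, and
`ArmSeparationExtSurgery.lean` / `ArmSeparationExtGuard.lean` record the corresponding step in those
frames (`OutTinyExt`, `OutTinyExtG`, `OutGoodG`); the landing line of `ArmSeparationOutCatch.lean`,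
`ArmSeparationOutMove.lean`, … works instead, as for the internal extremities
(`ArmSeparationInnerFrames.lean`), in the axis-compatible frames `frameIso i` (`id, ρ, σ, -id, ρ⁴, -σ`),
with corner guards keeping the tips in the middle of their side (`GoodTip`). This file provides
the step in that form, reusing the one-configuration bad event `outBad` (failure behind side `0`,
or a missing corner guard about `extC₁ M = (2M, -2M)` or `extC₂ M = (2M, 0)`), its probability
bound `real_outBad_le`, its support `determinedBy_outBad` and the surgery
`ext_tip_bounds_of_guards` of `ArmSeparationExtGuard.lean`:

* `OutGoodFr M T k₀ K R₀ Kg ω` — none of the twelve framed / colour-exchanged configurations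
  `frameConfig i ω`, `(frameConfig i ω)ᶜ` is in `outBad`;
* `OutMidTiny M n k₀ K R₀` — **the output of the outer separation step**: fenced arms
  (`TrapFencedArm`) with middle tips (`GoodTip`), the open one in some `frameConfig io ω`, the
  closed one in some `(frameConfig ic ω)ᶜ`;
* `exists_trapFencedArm_mid`, `armEvent_inter_outGoodFr_subset` — **surgery**:
  `armEvent ![true,false] n (2M) ∩ {OutGoodFr} ⊆ OutMidTiny` (the guards force the tips of the arms,
  which come from `Λ_M`, into the middle of the side);
* `real_not_outGoodFr_le` — `P(¬ OutGoodFr) ≤ 12 ((1 - c₄)^{T+1} + T (1 - c_F²)^K + 2 (1 - c_F²)^{Kg})`;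
* `norm_of_mem_outBadFinset`, `outBad_congr_shell`, `outGoodFr_congr`, `determinedBy_setOf_outGoodFr`
  — `outBad` reads only sites of the shell `{M < |v| ≤ 4M}`, which the frames preserve, so
  `OutGoodFr` is determined by the sites of that shell, hence
* `real_armEvent_le_outStepFr` — **the step inequality**
  `P(A₂(n,2M)) ≤ P(OutMidTiny M n k₀ K R₀) + P(¬ OutGoodFr M …) · P(A₂(n,M))`
  (union bound, monotonicity of the arm event in the outer radius, product formula for events
  determined by disjoint site sets).

## References

* P. Nolin, *Near-critical percolation in two dimensions*, Electron. J. Probab. 13 (2008), §4.4,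
  proof of Thm. 11, external extremities [arXiv 0711.4948: Thm. 10, p. 11–12]. [Nolin2008]
* H. Kesten, *Scaling relations for 2D-percolation*, Comm. Math. Phys. 109 (1987), Lemma 2. [Kesten1987]

Tree: `TrapFencedArm`, `exists_trapFencedArm`, `OutFail` (`ArmSeparationOuter.lean`);
`outFailFinset`, `lt_apply_zero_of_mem_outFailFinset` (`ArmSeparationOuterFail.lean`); `outBad`,
`GoodTip`, `extC₁`, `extC₂`, `ext_tip_bounds_of_guards`, `real_outBad_le`, `outBadFinset`,
`lt_apply_zero_of_mem_outBadFinset`, `determinedBy_outBad` (`ArmSeparationExtGuard.lean`);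
`frameIso`, `frameConfig`, `real_preimage_frameConfig`, `pathIn_frameConfig`,
`exists_frame_symm_apply_zero_eq`, `triNorm_frameIso`, `triNorm_frameIso_symm`
(`ArmSeparationInnerFrames.lean`); `InGuard`, `trapScale`, `le_trapScale`, `one_le_trapScale`;
`armEvent_two_eq_inter`, `determinedBy_armEvent`, `armEvent_mono_holds`,
`mem_armEvent_one_iff_exists_pathIn`, `sitePercolation_real_inter_of_disjoint`.
-/

noncomputable section

open MeasureTheory Set

namespace Literature.Probability.Percolation

open LatticeModels

/-! ### The good event, the output event -/

/-- **Nothing fails around `∂Λ_{2M}`, framed version with corner guards**: none of the twelve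
framed / colour-exchanged configurations `frameConfig i ω`, `(frameConfig i ω)ᶜ` (`i < 6`) is bad
(`outBad`: failure behind side `0`, or a missing corner guard). [cite: Nolin2008, §4.4 (arXiv 0711.4948: proof of Thm. 10, first step)] -/
def OutGoodFr (M T k₀ K R₀ Kg : ℕ) (ω : SiteConfig (Site 2)) : Prop :=
  ∀ i < 6, frameConfig i ω ∉ outBad M T k₀ K R₀ Kg ∧ (frameConfig i ω)ᶜ ∉ outBad M T k₀ K R₀ Kg

/-- **The output of the outer separation step** (Nolin's `Ã^{·/η'}(2^k, 2^K)`: the arms can be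
made well-separated on the external boundary, at the microscopic scales `k₀ · 32^j`): in some frame
`io < 6` a fenced open arm of `frameConfig io ω` (`TrapFencedArm`: tip on side `0` of `∂Λ_{2M}`,
fenced protected tip, open paths of the annulus `{n ≤ |v| ≤ 2M}` from a site of norm `n`) with a
middle tip (`GoodTip`), and in some frame `ic < 6` a fenced closed arm (an open arm of
`(frameConfig ic ω)ᶜ`) with a middle tip. [cite: Nolin2008, §4.4 (arXiv 0711.4948: proof of Thm. 10, p. 12)] -/
def OutMidTiny (M n k₀ K R₀ : ℕ) : Set (SiteConfig (Site 2)) :=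
  {ω | ∃ io < 6, ∃ ic < 6, (∃ Fo : TrapFencedArm M n k₀ K (frameConfig io ω), GoodTip M R₀ Fo.z) ∧
    ∃ Fc : TrapFencedArm M n k₀ K (frameConfig ic ω)ᶜ, GoodTip M R₀ Fc.z}

/-! ### Surgery: guards force middle tips -/

/-- **Fenced arms with middle tips exist off the bad event**: if `χ ∉ outBad` (no failure behind
side `0`, both corner guards present at scales `R₀ · 32^i`, `i < Kg`, with `2 · R₀ 32^i ≤ M`), then
every `χ`-open path of the annulus `{n ≤ |v| ≤ 2M}` from a site of norm `n ≤ M` to `trapO M`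
yields a fenced arm (`exists_trapFencedArm`) whose tip is a middle tip
(`ext_tip_bounds_of_guards` applied to its own tip path). [cite: Nolin2008, §4.4 Lemma 15 and Thm. 11 (proof) (arXiv 0711.4948: Lemma 14, Thm. 10)] -/
theorem exists_trapFencedArm_mid {M n T k₀ K R₀ Kg : ℕ} (hnM : n ≤ M) (hR₀ : 1 ≤ R₀) (hRg : ∀ i < Kg, 2 * trapScale R₀ i ≤ M)
    {χ : SiteConfig (Site 2)} (hχ : χ ∉ outBad M T k₀ K R₀ Kg)
    {a y : Site 2} (ha : triNorm a = n) (hy : y ∈ trapO M) (hp : PathIn triGraph (triAnnSet n (2 * M) ∩ χ) a y) :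
    ∃ F : TrapFencedArm M n k₀ K χ, GoodTip M R₀ F.z := by
  simp only [outBad, Set.mem_setOf_eq, not_or, not_not] at hχ
  obtain ⟨hfail, ⟨i₀, hi₀, hG₀⟩, ⟨i₁, hi₁, hG₁⟩⟩ := hχ
  simp only [OutFail, not_or, not_exists, not_and, ne_eq, not_not] at hfail
  obtain ⟨hT, hOK⟩ := hfail
  obtain ⟨F⟩ := exists_trapFencedArm hnM hT hOK ha hy hp
  have hk₀ : 1 ≤ trapScale R₀ i₀ := one_le_trapScale hR₀ _
  have hk₁ : 1 ≤ trapScale R₀ i₁ := one_le_trapScale hR₀ _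
  have hmid := ext_tip_bounds_of_guards hk₀ (hRg i₀ hi₀) hk₁ (hRg i₁ hi₁) hG₀.1 hG₁.1
    (by rw [F.norm_a]; exact_mod_cast hnM) F.z_mem F.path_tip
  have hR₀k₀ : (R₀ : ℤ) ≤ trapScale R₀ i₀ := by exact_mod_cast le_trapScale R₀ i₀
  have hR₀k₁ : (R₀ : ℤ) ≤ trapScale R₀ i₁ := by exact_mod_cast le_trapScale R₀ i₁
  exact ⟨F, by omega, by omega⟩

/-- **An arm lands on side `0` of some frame.** If `ω ∈ armEvent ![b] n (2M)` (`n ≤ 2M`, `1 ≤ M`)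
then for some `i < 6` the framed configuration `frameConfig i ω` has a colour-`b` `𝕋`-path of the
annulus `{n ≤ |v| ≤ 2M}` from a site `a` of norm `n` to a site of `trapO M` (the arm of
`mem_armEvent_one_iff_exists_pathIn`, carried by `(frameIso i)⁻¹` for the `i` placing its endpoint
on side `0`; the frames preserve the norm). [cite: Nolin2008, §4.4 (arXiv 0711.4948: proof of Thm. 10)] -/
theorem exists_trapO_pathIn_frame {b : Bool} {n M : ℕ} (hM : 1 ≤ M) (hn : n ≤ 2 * M) {ω : SiteConfig (Site 2)}
    (h : ω ∈ armEvent ![b] n (2 * M)) :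
    ∃ i < 6, ∃ a y : Site 2, triNorm a = n ∧ y ∈ trapO M ∧
      PathIn triGraph (triAnnSet n (2 * M) ∩ {v | v ∈ frameConfig i ω ↔ b}) a y := by
  obtain ⟨x, hx, y, hy, hp⟩ := (mem_armEvent_one_iff_exists_pathIn hn).1 h
  rw [mem_triSphere_iff] at hx hy
  obtain ⟨i, hi, hi0⟩ := exists_frame_symm_apply_zero_eq y
  have hp' : PathIn triGraph (triAnnSet n (2 * M) ∩ {v | v ∈ ω ↔ b}) x y :=
    hp.mono fun v hv => ⟨⟨hv.1.1, by push_cast; exact hv.1.2⟩, hv.2⟩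
  have hq := pathIn_frameConfig i hp'
  refine ⟨i, hi, (frameIso i).symm x, (frameIso i).symm y, by rw [triNorm_frameIso_symm i hi, hx], ?_, hq.mono ?_⟩
  · refine mem_trapO_of_apply_zero_eq hM (by rw [triNorm_frameIso_symm i hi, hy]; push_cast; ring) ?_
    rw [hi0, hy]; push_cast; ring
  · rintro w ⟨⟨v, hv, rfl⟩, hw⟩
    refine ⟨?_, hw⟩
    rw [mem_triAnnSet] at hv ⊢
    rw [show ((frameIso i).symm : triGraph ≃g triGraph) v = (frameIso i).symm v from rfl, triNorm_frameIso_symm i hi]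
    exact hv

/-- **On the two-arm event, if nothing fails around `∂Λ_{2M}` and the corners are guarded, both
arms are fenced with middle tips**: `armEvent ![true,false] n (2M) ∩ {OutGoodFr} ⊆ OutMidTiny M n k₀ K R₀`
(`1 ≤ M`, `n ≤ M`, `1 ≤ R₀`, `2 · R₀ 32^i ≤ M` for `i < Kg`). [cite: Nolin2008, §4.4 (arXiv 0711.4948: proof of Thm. 10, first step)] -/
theorem armEvent_inter_outGoodFr_subset {M n T k₀ K R₀ Kg : ℕ} (hM : 1 ≤ M) (hnM : n ≤ M) (hR₀ : 1 ≤ R₀)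
    (hRg : ∀ i < Kg, 2 * trapScale R₀ i ≤ M) :
    armEvent ![true, false] n (2 * M) ∩ {ω | OutGoodFr M T k₀ K R₀ Kg ω} ⊆ OutMidTiny M n k₀ K R₀ := by
  rintro ω ⟨harm, hgood⟩
  rw [armEvent_two_eq_inter] at harm
  obtain ⟨ho, hc⟩ := harm
  have hn2 : n ≤ 2 * M := by omega
  obtain ⟨io, hio, ao, yo, hao, hyo, hpo⟩ := exists_trapO_pathIn_frame hM hn2 ho
  obtain ⟨ic, hic, ac, yc, hac, hyc, hpc⟩ := exists_trapO_pathIn_frame hM hn2 hc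
  rw [setOf_mem_iff_true] at hpo
  rw [setOf_mem_iff_false] at hpc
  exact ⟨io, hio, ic, hic, exists_trapFencedArm_mid hnM hR₀ hRg (hgood io hio).1 hao hyo hpo,
    exists_trapFencedArm_mid hnM hR₀ hRg (hgood ic hic).2 hac hyc hpc⟩

/-! ### Probability of failure -/

/-- Off `OutGoodFr`, one of the twelve framed configurations is bad. [folklore] -/
theorem not_outGoodFr_subset (M T k₀ K R₀ Kg : ℕ) :
    {ω : SiteConfig (Site 2) | ¬ OutGoodFr M T k₀ K R₀ Kg ω} ⊆
      ⋃ i ∈ Finset.range 6, (frameConfig i ⁻¹' outBad M T k₀ K R₀ Kg ∪ frameConfig i ⁻¹' (compl ⁻¹' outBad M T k₀ K R₀ Kg)) := by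
  intro ω hω
  simp only [Set.mem_setOf_eq, OutGoodFr, not_forall] at hω
  obtain ⟨i, hi, h⟩ := hω
  simp only [Set.mem_iUnion, Set.mem_union, Set.mem_preimage, Finset.mem_range]
  refine ⟨i, hi, ?_⟩
  by_contra hno
  simp only [not_or] at hno
  exact h ⟨hno.1, hno.2⟩

/-- **Nothing fails around `∂Λ_{2M}` (framed, guarded) except with small probability** — the
"`(4δ)`" of Nolin's first step: for `M ≥ 3`, `k₀, R₀ ≥ 1` and `16 k_j + 1 ≤ M` (`j < K`),
`P(¬ OutGoodFr M T k₀ K R₀ Kg) ≤ 12 · ((1 - c₄)^{T+1} + T (1 - c_F²)^K + 2 (1 - c_F²)^{Kg})`, where `c_F`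
is the frame constant and `c₄` the RSW constant at aspect ratio `4`; the bound does not depend on
`M`, and is made small by choosing `T` first, then `K` and `Kg`. [cite: Nolin2008, §4.4 Lemma 15 and Thm. 11 (proof) (arXiv 0711.4948: Lemma 14 (4.20), Thm. 10)] -/
theorem real_not_outGoodFr_le {cF c₄ : ℝ} (hcF : 0 < cF)
    (hF : ∀ (z : Site 2) (k : ℕ), 1 ≤ k → cF ≤ (triSitePercolation half).real (triFrameAt z k))
    (hrsw : ∀ n : ℕ, 1 ≤ ⌊(4 : ℝ) * n⌋₊ → c₄ ≤ triLRCrossingProb half ⌊(4 : ℝ) * n⌋₊ n)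
    {M T k₀ K R₀ Kg : ℕ} (hM : 3 ≤ M) (hk₀ : 1 ≤ k₀) (hR₀ : 1 ≤ R₀) (hKM : ∀ j < K, 16 * (trapScale k₀ j : ℤ) + 1 ≤ M) :
    (triSitePercolation half).real {ω | ¬ OutGoodFr M T k₀ K R₀ Kg ω} ≤
      12 * ((1 - c₄) ^ (T + 1) + T * (1 - cF ^ 2) ^ K + 2 * (1 - cF ^ 2) ^ Kg) := by
  set B := outBad M T k₀ K R₀ Kg with hB
  set ε := (1 - c₄) ^ (T + 1) + T * (1 - cF ^ 2) ^ K + 2 * (1 - cF ^ 2) ^ Kg with hε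
  have hbad : (triSitePercolation half).real B ≤ ε := real_outBad_le hcF hF hrsw hM hk₀ hR₀ hKM
  have hrot : ∀ i : ℕ, (triSitePercolation half).real (frameConfig i ⁻¹' B) ≤ ε := fun i => by
    rw [real_preimage_frameConfig]; exact hbad
  have hrotc : ∀ i : ℕ, (triSitePercolation half).real (frameConfig i ⁻¹' (compl ⁻¹' B)) ≤ ε := fun i => by
    rw [real_preimage_frameConfig]
    unfold triSitePercolation
    rw [sitePercolation_real_preimage_compl, symm_half]
    exact hbad
  calc (triSitePercolation half).real {ω | ¬ OutGoodFr M T k₀ K R₀ Kg ω}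
      ≤ (triSitePercolation half).real
          (⋃ i ∈ Finset.range 6, (frameConfig i ⁻¹' B ∪ frameConfig i ⁻¹' (compl ⁻¹' B))) :=
        measureReal_mono (not_outGoodFr_subset M T k₀ K R₀ Kg) (measure_ne_top _ _)
    _ ≤ ∑ i ∈ Finset.range 6, (triSitePercolation half).real (frameConfig i ⁻¹' B ∪ frameConfig i ⁻¹' (compl ⁻¹' B)) :=
        measureReal_biUnion_finset_le _ _
    _ ≤ ∑ i ∈ Finset.range 6, (ε + ε) := Finset.sum_le_sum fun i _ =>
        (measureReal_union_le _ _).trans (add_le_add (hrot i) (hrotc i))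
    _ = 12 * ε := by rw [Finset.sum_const, Finset.card_range, nsmul_eq_mul]; push_cast; ring

/-! ### Locality: the good event lives in `{M < |v| ≤ 4M}` -/

section Locality

variable {M : ℕ}

/-- Every site read by `outBad` lies in the shell `{M < |v| ≤ 4M}` (`R < M`, `R_g < M`). [folklore] -/
theorem norm_of_mem_outBadFinset {R Rg : ℕ} (hRM : R < M) (hRgM : Rg < M) {v : Site 2} (hv : v ∈ outBadFinset M R Rg) :
    (M : ℤ) < triNorm v ∧ triNorm v ≤ 4 * M := by
  refine ⟨lt_triNorm_of_lt_apply_zero (lt_apply_zero_of_mem_outBadFinset hRM hRgM hv), ?_⟩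
  have hRM' : (R : ℤ) < M := by exact_mod_cast hRM
  have hRgM' : (Rg : ℤ) < M := by exact_mod_cast hRgM
  rw [outBadFinset, Finset.mem_union, Finset.mem_union, outFailFinset, Finset.mem_union, Finset.mem_biUnion] at hv
  rcases hv with (hv | ⟨z, hz, hv⟩) | hv | hv
  · have := (mem_trapD_iff_triNorm.1 hv).2; omega
  · have hz' := trapO_coord hz
    rw [mem_triSquareFinset] at hv
    exact triNorm_le_iff_lin.2 (by omega)
  · rw [mem_triSquareFinset] at hv
    simp only [extC₁, site_mk_apply_zero, site_mk_apply_one] at hv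
    exact triNorm_le_iff_lin.2 (by omega)
  · rw [mem_triSquareFinset] at hv
    simp only [extC₂, site_mk_apply_zero, site_mk_apply_one] at hv
    exact triNorm_le_iff_lin.2 (by omega)

/-- **Locality of the bad event**: `outBad M …` only depends on the configuration on the shell
`{M < |v| ≤ 4M}` (`1 ≤ M`, `2 k_j + 1 ≤ R < M`, `16 · R₀ 32^i ≤ R_g < M`; `determinedBy_outBad`). [folklore] -/
theorem outBad_congr_shell {T k₀ K R₀ Kg R Rg : ℕ} (hM : 1 ≤ M) (hR : ∀ j < K, 2 * trapScale k₀ j + 1 ≤ R) (hRM : R < M)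
    (hRg : ∀ i < Kg, 16 * trapScale R₀ i ≤ Rg) (hRgM : Rg < M) {χ χ' : Set (Site 2)}
    (hagree : ∀ v : Site 2, (M : ℤ) < triNorm v → triNorm v ≤ 4 * M → (v ∈ χ ↔ v ∈ χ')) :
    χ ∈ outBad M T k₀ K R₀ Kg ↔ χ' ∈ outBad M T k₀ K R₀ Kg := by
  refine (determinedBy_iff _ _).1 (determinedBy_outBad (T := T) hM hR hRg) χ χ' (Set.ext fun v => ?_)
  simp only [Set.mem_inter_iff, Finset.mem_coe]
  constructor
  · rintro ⟨h1, h2⟩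
    obtain ⟨hv, hv'⟩ := norm_of_mem_outBadFinset hRM hRgM h2
    exact ⟨(hagree v hv hv').1 h1, h2⟩
  · rintro ⟨h1, h2⟩
    obtain ⟨hv, hv'⟩ := norm_of_mem_outBadFinset hRM hRgM h2
    exact ⟨(hagree v hv hv').2 h1, h2⟩

/-- **Locality of the good event**: `OutGoodFr M …` only depends on the configuration on
`{M < |v| ≤ 4M}` (the frames preserve the norm). [folklore] -/
theorem outGoodFr_congr {T k₀ K R₀ Kg R Rg : ℕ} (hM : 1 ≤ M) (hR : ∀ j < K, 2 * trapScale k₀ j + 1 ≤ R) (hRM : R < M)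
    (hRg : ∀ i < Kg, 16 * trapScale R₀ i ≤ Rg) (hRgM : Rg < M) {ω ω' : Set (Site 2)}
    (hagree : ∀ v : Site 2, (M : ℤ) < triNorm v → triNorm v ≤ 4 * M → (v ∈ ω ↔ v ∈ ω')) :
    OutGoodFr M T k₀ K R₀ Kg ω ↔ OutGoodFr M T k₀ K R₀ Kg ω' := by
  have hfr : ∀ i < 6, ∀ v : Site 2, (M : ℤ) < triNorm v → triNorm v ≤ 4 * M → (v ∈ frameConfig i ω ↔ v ∈ frameConfig i ω') := by
    intro i hi v hv hv'
    rw [mem_frameConfig, mem_frameConfig]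
    exact hagree _ (by rw [triNorm_frameIso i hi]; exact hv) (by rw [triNorm_frameIso i hi]; exact hv')
  have hfrc : ∀ i < 6, ∀ v : Site 2, (M : ℤ) < triNorm v → triNorm v ≤ 4 * M → (v ∈ (frameConfig i ω)ᶜ ↔ v ∈ (frameConfig i ω')ᶜ) :=
    fun i hi v hv hv' => not_congr (hfr i hi v hv hv')
  unfold OutGoodFr
  refine forall₂_congr fun i hi => ?_
  rw [outBad_congr_shell (T := T) (k₀ := k₀) (K := K) (R₀ := R₀) (Kg := Kg) hM hR hRM hRg hRgM (hfr i hi),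
    outBad_congr_shell (T := T) (k₀ := k₀) (K := K) (R₀ := R₀) (Kg := Kg) hM hR hRM hRg hRgM (hfrc i hi)]

/-- The sites read by `OutGoodFr`: `{M < |v| ≤ 4M}`. [folklore] -/
def outGoodFrFinset (M : ℕ) : Finset (Site 2) := (triBall (4 * M)).filter fun v => (M : ℤ) < triNorm v

/-- Membership in `outGoodFrFinset`. [folklore] -/
theorem mem_outGoodFrFinset {v : Site 2} : v ∈ outGoodFrFinset M ↔ (M : ℤ) < triNorm v ∧ triNorm v ≤ 4 * M := by
  rw [outGoodFrFinset, Finset.mem_filter, mem_triBall_iff]; push_cast; tauto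

/-- **`OutGoodFr` is determined by the sites of `{M < |v| ≤ 4M}`** — finitely many sites, all
outside `Λ_M`. [cite: Nolin2008, §4.4 (arXiv 0711.4948: proof of Thm. 10, "by independence")] -/
theorem determinedBy_setOf_outGoodFr {T k₀ K R₀ Kg R Rg : ℕ} (hM : 1 ≤ M) (hR : ∀ j < K, 2 * trapScale k₀ j + 1 ≤ R) (hRM : R < M)
    (hRg : ∀ i < Kg, 16 * trapScale R₀ i ≤ Rg) (hRgM : Rg < M) :
    DeterminedBy {ω : SiteConfig (Site 2) | OutGoodFr M T k₀ K R₀ Kg ω} ↑(outGoodFrFinset M) := by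
  rw [determinedBy_iff]
  intro ω ω' hω
  simp only [Set.mem_setOf_eq]
  refine outGoodFr_congr hM hR hRM hRg hRgM fun v hv hv' => ?_
  have key := Set.ext_iff.1 hω v
  simp only [Set.mem_inter_iff, Finset.mem_coe, mem_outGoodFrFinset] at key
  exact ⟨fun h => (key.1 ⟨h, hv, hv'⟩).1, fun h => (key.2 ⟨h, hv, hv'⟩).1⟩

/-- `outGoodFrFinset M` is disjoint from the ball `Λ_M`. [folklore] -/
theorem disjoint_outGoodFrFinset_triBall (M : ℕ) : Disjoint (outGoodFrFinset M) (triBall M) := by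
  rw [Finset.disjoint_left]
  intro v hv hvB
  rw [mem_outGoodFrFinset] at hv
  have h2 := mem_triBall_iff.1 hvB
  omega

end Locality

/-! ### The step inequality -/

/-- **The external separation step** (Nolin 2008, §4.4, p. 12:
`P(A(2^k,2^K)) ≤ P(Ã^{·/η'}(2^k,2^K)) + 4δ · P(A(2^k,2^{K-1}))`): for `1 ≤ M`, `n ≤ M`, `1 ≤ R₀`,
`2 k_j + 1 ≤ R < M` (`j < K`), `16 · R₀ 32^i ≤ Rg < M` and `2 · R₀ 32^i ≤ M` (`i < Kg`),
`P(A₂(n, 2M)) ≤ P(OutMidTiny M n k₀ K R₀) + P(¬ OutGoodFr M …) · P(A₂(n, M))` (`2 · R₀ 32^i ≤ M`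
follows from the guard bounds): off `OutGoodFr` the arms still cross `Λ_M ∖ Λ_n` (`armEvent_mono_holds`), an event determined by the sites of `Λ_M`,
independent of `OutGoodFr` (determined by `{M < |v| ≤ 4M}`). [cite: Nolin2008, §4.4 (arXiv 0711.4948: proof of Thm. 10, p. 12)] -/
theorem real_armEvent_le_outStepFr {M n T k₀ K R₀ Kg R Rg : ℕ} (hM : 1 ≤ M) (hnM : n ≤ M) (hR₀ : 1 ≤ R₀)
    (hR : ∀ j < K, 2 * trapScale k₀ j + 1 ≤ R) (hRM : R < M) (hRg : ∀ i < Kg, 16 * trapScale R₀ i ≤ Rg) (hRgM : Rg < M) :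
    (triSitePercolation half).real (armEvent ![true, false] n (2 * M)) ≤
      (triSitePercolation half).real (OutMidTiny M n k₀ K R₀) +
        (triSitePercolation half).real {ω | ¬ OutGoodFr M T k₀ K R₀ Kg ω} *
          (triSitePercolation half).real (armEvent ![true, false] n M) := by
  classical
  have hRg' : ∀ i < Kg, 2 * trapScale R₀ i ≤ M := fun i hi => by have := hRg i hi; omega
  have hsub : armEvent ![true, false] n (2 * M) ⊆
      OutMidTiny M n k₀ K R₀ ∪ ({ω | ¬ OutGoodFr M T k₀ K R₀ Kg ω} ∩ armEvent ![true, false] n M) := by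
    intro ω hω
    by_cases hg : OutGoodFr M T k₀ K R₀ Kg ω
    · exact Or.inl (armEvent_inter_outGoodFr_subset hM hnM hR₀ hRg' ⟨hω, hg⟩)
    · exact Or.inr ⟨hg, armEvent_mono_holds _ hnM (by omega) hω⟩
  -- independence
  have dG : DeterminedBy {ω : SiteConfig (Site 2) | ¬ OutGoodFr M T k₀ K R₀ Kg ω} ↑(outGoodFrFinset M) :=
    (determinedBy_setOf_outGoodFr hM hR hRM hRg hRgM).compl
  have dE : DeterminedBy (armEvent ![true, false] n M) ↑(triBall M) := by
    refine (determinedBy_armEvent ![true, false] hnM).mono ?_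
    intro v hv
    rw [Finset.mem_coe, mem_triAnnulus] at hv
    rw [Finset.mem_coe, mem_triBall_iff]
    exact hv.2
  have hind := sitePercolation_real_inter_of_disjoint half dG dE (disjoint_outGoodFrFinset_triBall M)
  unfold triSitePercolation at hind ⊢
  calc (sitePercolation (Site 2) half).real (armEvent ![true, false] n (2 * M))
      ≤ (sitePercolation (Site 2) half).real
          (OutMidTiny M n k₀ K R₀ ∪ ({ω | ¬ OutGoodFr M T k₀ K R₀ Kg ω} ∩ armEvent ![true, false] n M)) :=
        measureReal_mono hsub (measure_ne_top _ _)
    _ ≤ (sitePercolation (Site 2) half).real (OutMidTiny M n k₀ K R₀) +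
          (sitePercolation (Site 2) half).real ({ω | ¬ OutGoodFr M T k₀ K R₀ Kg ω} ∩ armEvent ![true, false] n M) :=
        measureReal_union_le _ _
    _ = _ := by rw [hind]

end Literature.Probability.Percolation
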